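import Mathlib
import HarnessLib
import Literature.Analysis.FluidPDE.VectorCalculus
import Summits.NavierStokesRegularity.NavierStokesRegularity.Theorems.UnthreadedRigidityDoorUnthreadedRigidityCoZonalSameDegree
import Summits.NavierStokesRegularity.NavierStokesRegularity.Theorems.ThreadingFluxLoopLawSameDegreeBracketRigidity
import Summits.NavierStokesRegularity.NavierStokesRegularity.Theorems.ThreadingFluxHorizonTowerZonalUniqueness

/-!
# W2 door `UnthreadedRigidity` (stmt-NavierStokesRegularity-27585) — ONE FACT, TWO CURRENCIES: the W1 cell's polynomial bracket rigidity
# (`PoloidalLiouville.LoopLaw.sameDegreeBracketRigidity`, `HorizonTower.zonal_unique`) ↔ the W2 door's analytic form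
# (`CoZonal.dependent_of_poissonCommute`, `VirialHorn.IsSolidHarmonic.zonal_line`)

Corollary file (engine-1 g72, DIRECTOR-NS dss_164 (2) / dss_165 (1); `--supports stmt-NavierStokesRegularity-27585 --as helper`; no Theses module in
the closure).  The SAME-DEGREE BRACKET RIGIDITY («two solid harmonics of one degree that Poisson-commute are proportional») and the ZONAL LINE
(«two zonal solid harmonics of one degree about one axis are proportional») were in the tree FIRST in the W1 cell's currency
(`MvPolynomial` / `Zonal.evalE`, route ThreadingFlux, crux ⟨1222⟩; `LoopLaw.sameDegreeBracketRigidity` p684047, `HorizonTower.zonal_unique`) and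
were re-proved independently in the W2 currency (`VirialHorn.IsSolidHarmonic`, `IsZonalAbout`, `pbr`; p718618, p717885).  This file records
that each currency's statement is a one-screen corollary of the other, through the W1 bridge `Zonal.fderiv_evalE_apply`, `Zonal.laplacian_evalE`,
`Zonal.eq_zero_of_evalE_eq_zero`, `LoopLaw.loopBracket_evalE` (private copies of ns-crc-p2 g9's `lap3_evalE` dictionary, p717663, whose olean
the farm has not built at filing time):
* `eq_smul_of_poissonCommute` — W2 currency, W1 shape (`∃ c, Y₂ = cY₁` when `Y₁ ≢ 0`), FROM `LoopLaw.sameDegreeBracketRigidity`;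
* `sameDegreeBracketRigidity_detP` — W1 polynomial currency (`detP A B = 0 ⇒ B = c•A`), FROM `CoZonal.dependent_of_poissonCommute`;
* `IsSolidHarmonic.eq_smul_of_isZonalAbout` — the zonal line in W2 currency, W1 shape, FROM `HorizonTower.zonal_unique`.

HONEST LABEL: bookkeeping between two cells' vocabularies; no rung moves; `UnthreadedRigidity` (27585), `PoloidalLiouville` (1222), W1, W2 and NS
regularity remain OPEN; nothing here is a statement about Navier–Stokes regularity.  0 kit.
-/

noncomputable section

-- the summit and its single sub-problem share the name (CONVENTIONS §1), as in every Theorems file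
set_option linter.dupNamespace false

namespace Summit.NavierStokesRegularity.NavierStokesRegularity.Theorems.UnthreadedRigidity.CoZonal

open scoped Topology InnerProductSpace
open Filter Set
open Literature.Analysis.FluidPDE (cross)
open Summit.NavierStokesRegularity.NavierStokesRegularity.Theorems.UnthreadedRigidity.VirialHorn
open Summit.NavierStokesRegularity.NavierStokesRegularity.Theorems.UnthreadedRigidity.ProfileHorn (E3)
open Summit.NavierStokesRegularity.NavierStokesRegularity.Theorems.PoloidalLiouville (HorizonTower.Zonal.evalE HorizonTower.Zonal.detP
  HorizonTower.Zonal.lapP)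
open Summit.NavierStokesRegularity.NavierStokesRegularity.Theorems.PoloidalLiouville.HorizonTower (Zonal.laplacian_evalE
  Zonal.eq_zero_of_evalE_eq_zero Zonal.fderiv_evalE_apply zonal_unique)
open Summit.NavierStokesRegularity.NavierStokesRegularity.Theorems.PoloidalLiouville.LoopLaw (sameDegreeBracketRigidity loopBracket_evalE)

/-- the W2 bracket is the W1 loop bracket: `pbr Y₁ Y₂ y = ⟪y, ∇Y₁ × ∇Y₂⟫`. -/
private theorem pbr_eq_inner_cross' (f g : E3 → ℝ) (y : E3) : pbr f g y = ⟪y, cross (gradient f y) (gradient g y)⟫_ℝ := by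
  simp only [pbr, det3, PiLp.inner_apply, Fin.sum_univ_three, cross, cross_apply, RCLike.inner_apply, conj_trivial]
  simp; ring

/-- `lap3` of a polynomial function is the polynomial Laplacian (private copy of ns-crc-p2's `lap3_evalE`). -/
private theorem lap3_evalE' (p : MvPolynomial (Fin 3) ℝ) (y : E3) :
    lap3 (HorizonTower.Zonal.evalE p) y = HorizonTower.Zonal.evalE (HorizonTower.Zonal.lapP p) y := by
  have hdir : ∀ (q : MvPolynomial (Fin 3) ℝ) (i : Fin 3),
      (fun z : E3 => fderiv ℝ (HorizonTower.Zonal.evalE q) z (e i)) = HorizonTower.Zonal.evalE (MvPolynomial.pderiv i q) := by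
    intro q i
    funext z
    rw [Zonal.fderiv_evalE_apply, Fin.sum_univ_three]
    fin_cases i <;> simp [e]
  unfold lap3 dir2
  simp only [hdir]
  rw [Fin.sum_univ_three]
  simp only [Zonal.fderiv_evalE_apply, Fin.sum_univ_three]
  simp [e, HorizonTower.Zonal.lapP]

/-- a W2 solid harmonic is a homogeneous polynomial with `lapP = 0` (private copy of ns-crc-p2's `IsSolidHarmonic.exists_evalE`). -/
private theorem exists_evalE' {l : ℕ} {Y : E3 → ℝ} (hY : IsSolidHarmonic l Y) :
    ∃ P : MvPolynomial (Fin 3) ℝ, P.IsHomogeneous l ∧ HorizonTower.Zonal.lapP P = 0 ∧ Y = HorizonTower.Zonal.evalE P := by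
  obtain ⟨⟨P, hPh, hPe⟩, hlap⟩ := hY
  have hYP : Y = HorizonTower.Zonal.evalE P := funext fun y => hPe y
  refine ⟨P, hPh, ?_, hYP⟩
  apply Zonal.eq_zero_of_evalE_eq_zero
  intro y
  rw [← lap3_evalE', ← hYP]
  exact hlap y

/-- ★ **W1 ⇒ W2**: same-degree bracket rigidity in the W2 door's currency, W1 shape — two solid harmonics of degree `l ≥ 1` that Poisson-commute,
the first not identically zero, are proportional.  FROM `LoopLaw.sameDegreeBracketRigidity` through the `evalE` dictionary. -/
theorem eq_smul_of_poissonCommute {l : ℕ} {Y₁ Y₂ : E3 → ℝ} (hY₁ : IsSolidHarmonic l Y₁) (hY₂ : IsSolidHarmonic l Y₂) (hl : 1 ≤ l)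
    (hP : PoissonCommute Y₁ Y₂) (hne : ∃ y, Y₁ y ≠ 0) : ∃ c : ℝ, ∀ y, Y₂ y = c * Y₁ y := by
  obtain ⟨A, hAh, hAl, hYA⟩ := exists_evalE' hY₁
  obtain ⟨B, hBh, hBl, hYB⟩ := exists_evalE' hY₂
  have hA0 : A ≠ 0 := by
    rintro rfl
    obtain ⟨y, hy⟩ := hne
    exact hy (by rw [hYA]; simp [HorizonTower.Zonal.evalE])
  have hlapA : ∀ y : E3, Laplacian.laplacian (fun y : E3 => MvPolynomial.eval (fun i => y i) A) y = 0 := fun y => by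
    show Laplacian.laplacian (HorizonTower.Zonal.evalE A) y = 0
    rw [Zonal.laplacian_evalE, hAl]; simp
  have hlapB : ∀ y : E3, Laplacian.laplacian (fun y : E3 => MvPolynomial.eval (fun i => y i) B) y = 0 := fun y => by
    show Laplacian.laplacian (HorizonTower.Zonal.evalE B) y = 0
    rw [Zonal.laplacian_evalE, hBl]; simp
  have hbr : ∀ y : E3, inner ℝ y (cross (gradient (fun y : E3 => MvPolynomial.eval (fun i => y i) A) y)
      (gradient (fun y : E3 => MvPolynomial.eval (fun i => y i) B) y)) = 0 := fun y => by
    have h := hP y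
    rw [hYA, hYB, pbr_eq_inner_cross'] at h
    exact h
  obtain ⟨c, hc⟩ := sameDegreeBracketRigidity l A B hl ⟨hAh, hlapA⟩ ⟨hBh, hlapB⟩ hA0 hbr
  refine ⟨c, fun y => ?_⟩
  rw [hYA, hYB, hc]
  simp [HorizonTower.Zonal.evalE, MvPolynomial.smul_eval]

/-- ★ **W2 ⇒ W1**: same-degree bracket rigidity in the W1 cell's POLYNOMIAL currency — `A, B` homogeneous of degree `l ≥ 1` with `lapP = 0`,
`A ≠ 0`, `detP A B = 0` ⇒ `B = c • A`.  FROM `CoZonal.dependent_of_poissonCommute` through the same dictionary. -/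
theorem sameDegreeBracketRigidity_detP {l : ℕ} (hl : 1 ≤ l) {A B : MvPolynomial (Fin 3) ℝ} (hAh : A.IsHomogeneous l)
    (hBh : B.IsHomogeneous l) (hAl : HorizonTower.Zonal.lapP A = 0) (hBl : HorizonTower.Zonal.lapP B = 0) (hA0 : A ≠ 0)
    (hdet : HorizonTower.Zonal.detP A B = 0) : ∃ c : ℝ, B = c • A := by
  have hY₁ : IsSolidHarmonic l (HorizonTower.Zonal.evalE A) :=
    ⟨⟨A, hAh, fun y => rfl⟩, fun y => by rw [lap3_evalE', hAl]; simp⟩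
  have hY₂ : IsSolidHarmonic l (HorizonTower.Zonal.evalE B) :=
    ⟨⟨B, hBh, fun y => rfl⟩, fun y => by rw [lap3_evalE', hBl]; simp⟩
  have hP : PoissonCommute (HorizonTower.Zonal.evalE A) (HorizonTower.Zonal.evalE B) := fun y => by
    show pbr (HorizonTower.Zonal.evalE A) (HorizonTower.Zonal.evalE B) y = 0
    rw [pbr_eq_inner_cross', loopBracket_evalE, hdet]; simp
  obtain ⟨c₁, c₂, hc, hrel⟩ := dependent_of_poissonCommute hY₁ hY₂ hl hP
  have hpoly : c₁ • A + c₂ • B = 0 := by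
    apply Zonal.eq_zero_of_evalE_eq_zero
    intro y
    have := hrel y
    simpa [HorizonTower.Zonal.evalE, MvPolynomial.smul_eval] using this
  by_cases h2 : c₂ = 0
  · exfalso
    have h1 : c₁ ≠ 0 := hc.resolve_right (fun h => h h2)
    rw [h2, zero_smul, add_zero] at hpoly
    exact hA0 ((smul_eq_zero.1 hpoly).resolve_left h1)
  · refine ⟨-c₁ / c₂, ?_⟩
    have : B = (c₂⁻¹) • (c₂ • B) := by rw [smul_smul, inv_mul_cancel₀ h2, one_smul]
    rw [this, show c₂ • B = -(c₁ • A) from eq_neg_of_add_eq_zero_right hpoly, smul_neg, smul_smul, ← neg_smul]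
    congr 1
    field_simp

/-- ★ **THE ZONAL LINE, W1 ⇒ W2**: two solid harmonics of degree `l`, zonal about the same axis `a ≠ 0`, the first not identically zero, are
proportional — FROM the W1 cell's `HorizonTower.zonal_unique` (the W2 door's own proof is `IsSolidHarmonic.zonal_line`, p717885). -/
theorem IsSolidHarmonic.eq_smul_of_isZonalAbout {l : ℕ} {Y₁ Y₂ : E3 → ℝ} (hY₁ : IsSolidHarmonic l Y₁) (hY₂ : IsSolidHarmonic l Y₂)
    {a : E3} (ha : a ≠ 0) (hz₁ : IsZonalAbout a Y₁) (hz₂ : IsZonalAbout a Y₂) (hne : ∃ y, Y₁ y ≠ 0) :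
    ∃ c : ℝ, ∀ y, Y₂ y = c * Y₁ y := by
  -- harmonicity in the `Laplacian.laplacian` currency through the polynomial dictionary
  have hlap : ∀ {Y : E3 → ℝ}, IsSolidHarmonic l Y → ∀ y, Laplacian.laplacian Y y = 0 := by
    intro Y hY y
    obtain ⟨P, _, hPl, hYP⟩ := exists_evalE' hY
    rw [hYP, Zonal.laplacian_evalE, hPl]; simp
  -- zonality in the `⟪a × x, ∇Y⟫` currency: `det3 a x (∇Y x) = ⟪a × x, ∇Y x⟫`
  have hzon : ∀ {Y : E3 → ℝ}, IsZonalAbout a Y → ∀ x : E3, ⟪cross a x, gradient Y x⟫_ℝ = 0 := by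
    intro Y hz x
    rw [← ThreadingJets.det3_eq_inner_cross]; exact hz x
  exact zonal_unique l Y₁ Y₂ ha hY₁.contDiff (fun c y => hY₁.apply_smul c y) (hlap hY₁) hY₂.contDiff
    (fun c y => hY₂.apply_smul c y) (hlap hY₂) (hzon hz₁) (hzon hz₂) hne

end Summit.NavierStokesRegularity.NavierStokesRegularity.Theorems.UnthreadedRigidity.CoZonal

end
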